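import Summits.Ventures.HSemireg.WedgeHankelRecurrenceGaussChebyshevRationalRootsTU

/-!
# Venture HSemireg — **GROWTH OFF THE INTERVAL: `U_n(x) ≥ n + 1` for `x ≥ 1`, `S_n(x) ≥ n + 1` for `x ≥ 2`, `C_n(x) ≥ 2` for `x ≥ 2` (strict off the endpoint for `n ≠ 0`), the absolute versions on
# `|x| ≥ 1` ∕ `|x| ≥ 2`, and the characterisations `|x| ≤ 1 ↔ |U_n(x)| ≤ n + 1`, `|x| ≤ 2 ↔ |S_n(x)| ≤ n + 1`, `|x| ≤ 2 ↔ |C_n(x)| ≤ 2` (`n ≠ 0`)** — the `U ∕ S ∕ C` companions of Mathlib's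
# `one_le_eval_T_real ∕ one_lt_abs_eval_T_real ∕ abs_eval_T_real_le_one_iff`

HONEST FRAMING. Part of the Lean index of the computation cell `pub-hsemireg` (seat p10 gen 49, Sunday typer «UNIFORM-IN-n»).  Real polynomial inequalities only (Mathlib `Polynomial.Chebyshev.T ∕ U ∕
C ∕ S` over `ℝ`); no variety, no cohomology theory, no sheaf, no Ext group and no semiregularity map is constructed here; nothing here says that HC / HC_CM / HC_AV holds; no Literature fact
(unproved `Prop`) is declared or used.  Custodian versions as in `WedgeHankelSiegelIdeal` (1/3).
SOURCES (cited).  T. J. Rivlin, *The Chebyshev Polynomials* (Wiley 1974), §1.2 and §2.7 (growth of `T_n`, `U_n` outside `[−1, 1]`); J. C. Mason, D. C. Handscomb, *Chebyshev Polynomials* (2003), §1.4;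
NIST DLMF §18.14 (the bounds `|T_n| ≤ 1`, `|U_n| ≤ n + 1` on `[−1, 1]`).
PROOF TYPED HERE.  (1) `U_{m+1} = X·U_m + T_{m+1}` (`Literature…FitznerVanDerHofstad2017.U_natCast_succ`) and Mathlib `one_le_eval_T_real` give `U_m(x) ≥ m + 1` for `x ≥ 1` by induction
(`x·U_m ≥ U_m ≥ m + 1`, `T_{m+1} ≥ 1`), strictly for `x > 1`, `m ≥ 1` (`one_lt_eval_T_real`); parity `U_n(−x) = (−1)^n U_n(x)` (Mathlib `U_eval_neg`) gives the `|x| ≥ 1` versions, and with the LANDED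
upper bound `Literature…FitznerVanDerHofstad2017.abs_eval_U_le` (`|U_n| ≤ n + 1` on `[−1, 1]`, imported through N444, USED not restated) the characterisation `|x| ≤ 1 ↔ |U_n(x)| ≤ n + 1` (`n ≠ 0`).
(2) `S_n(x) = U_n(x∕2)` and `C_n(x) = 2T_n(x∕2)` (Mathlib `S_comp_two_mul_X`, `C_comp_two_mul_X` at `x∕2`) transport (1) and Mathlib's `T`-statements to `[−2, 2]`.
DEDUP DISCLOSURE (`rg -n 'le_eval_U|U_real_le|abs_eval_S|abs_eval_C_real|abs_chebyshev[SC]_eval_le' Summits Literature`, 2026-09-04): the UPPER bounds exist and are NOT restated —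
`Literature.Probability.FitznerVanDerHofstad2017.abs_eval_U_le` (`|U_n| ≤ n+1`, used here), `…one_le_eval_U` (`1 ≤ U_m(x)`, weaker than `le_eval_chebyshevU_real` below),
`Literature.NumberTheory.LFunctions.GL2Family.abs_chebyshevS_eval_le` (`|S_e| ≤ e+1` on `[−2,2]`) and `Literature.NumberTheory.EllipticCurves.ModularForms.SymmSqLogEuler.abs_chebyshevC_eval_le`
(`|C_n| ≤ 2` on `[−2,2]`) — the last two live in modular-form files with heavy imports, so the `→` halves of the two `iff`s below are re-derived inline from the light `abs_eval_U_le` ∕ Mathlib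
`abs_eval_T_real_le_one` (three lines each, inside the proofs, no separate statement); Mathlib has the `T`-versions `one_le_eval_T_real`, `one_lt_eval_T_real`, `one_le_abs_eval_T_real`,
`one_lt_abs_eval_T_real`, `abs_eval_T_real_le_one_iff` only; N443 `abs_eval_chebyshevU_real_le` is the `(√(1−x²))⁻¹` bound; 0 hits for the 17 names below.

WHAT IS IN THE TREE.  As listed; Mathlib `S_comp_two_mul_X`, `C_comp_two_mul_X`, `U_eval_neg`, `Int.cast_negOnePow_natCast`.
THIS FILE (namespace `Summit.Ventures.HSemireg.Wedge.HankelOuter` continued; CHAINED on N520; 0 definitions):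
* §1286 **`le_eval_chebyshevU_real`** (`n + 1 ≤ U_n(x)`, `x ≥ 1`), **`lt_eval_chebyshevU_real`** (`<` for `x > 1`, `n ≠ 0`), **`le_abs_eval_chebyshevU_real`**, **`lt_abs_eval_chebyshevU_real`** (`|x| ≥ 1`),
  **`abs_eval_chebyshevU_real_le_iff`** (`|x| ≤ 1 ↔ |U_n(x)| ≤ n + 1`, `n ≠ 0`); `chebyshevS_eval_eq_U_eval_half` (`S_n(x) = U_n(x∕2)`), **`le_eval_chebyshevS_real`**, **`lt_eval_chebyshevS_real`**,
  **`le_abs_eval_chebyshevS_real`**, **`lt_abs_eval_chebyshevS_real`**, **`abs_eval_chebyshevS_real_le_iff`** (`|x| ≤ 2 ↔ |S_n(x)| ≤ n + 1`); `chebyshevC_eval_eq_two_mul_T_eval_half`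
  (`C_n(x) = 2T_n(x∕2)`), **`two_le_eval_chebyshevC_real`**, **`two_lt_eval_chebyshevC_real`**, **`two_le_abs_eval_chebyshevC_real`**, **`two_lt_abs_eval_chebyshevC_real`**,
  **`abs_eval_chebyshevC_real_le_two_iff`** (`|x| ≤ 2 ↔ |C_n(x)| ≤ 2`, `n ≠ 0`).
CAVEATS.  `U ∕ S` statements for `n ∈ ℕ`, `C` statements for `n ∈ ℤ`; the bounds are attained at the endpoints (`U_n(1) = S_n(2) = n + 1`, `C_n(2) = 2`, Mathlib `U_eval_one ∕ S_eval_two ∕ C_eval_two`).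
Nothing Ext-side.  New names only.
-/

open Module Polynomial
open scoped Matrix Polynomial

namespace Summit.Ventures.HSemireg.Wedge.HankelOuter

/-! ## §1286. Growth of `U_n`, `S_n`, `C_n` off the interval -/

/-! ### `U_n` on `|x| ≥ 1` -/

/-- **`n + 1 ≤ U_n(x)` for `x ≥ 1`** (equality at `x = 1`). [Rivlin 1974, §1.2; this file, §1286] -/
theorem le_eval_chebyshevU_real (n : ℕ) {x : ℝ} (hx : 1 ≤ x) : (n : ℝ) + 1 ≤ (Polynomial.Chebyshev.U ℝ (n : ℤ)).eval x := by
  induction n with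
  | zero => simp
  | succ m ih =>
    rw [Literature.Probability.FitznerVanDerHofstad2017.U_natCast_succ, eval_add, eval_mul, eval_X, Nat.cast_succ (R := ℝ)]
    have hT := Polynomial.Chebyshev.one_le_eval_T_real ((m + 1 : ℕ) : ℤ) hx
    have hm := Nat.cast_nonneg (α := ℝ) m
    have hu : (0 : ℝ) ≤ (Polynomial.Chebyshev.U ℝ (m : ℤ)).eval x := by linarith
    nlinarith [mul_nonneg (sub_nonneg.mpr hx) hu]

/-- **`n + 1 < U_n(x)` for `x > 1` and `n ≠ 0`.** [Rivlin 1974, §1.2; this file, §1286] -/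
theorem lt_eval_chebyshevU_real {n : ℕ} (hn : n ≠ 0) {x : ℝ} (hx : 1 < x) : (n : ℝ) + 1 < (Polynomial.Chebyshev.U ℝ (n : ℤ)).eval x := by
  obtain ⟨m, rfl⟩ := Nat.exists_eq_succ_of_ne_zero hn
  rw [Literature.Probability.FitznerVanDerHofstad2017.U_natCast_succ, eval_add, eval_mul, eval_X, Nat.cast_succ (R := ℝ)]
  have hT := Polynomial.Chebyshev.one_lt_eval_T_real (n := ((m + 1 : ℕ) : ℤ)) (by omega) hx
  have hu := le_eval_chebyshevU_real m hx.le
  have hm := Nat.cast_nonneg (α := ℝ) m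
  have hu0 : (0 : ℝ) ≤ (Polynomial.Chebyshev.U ℝ (m : ℤ)).eval x := by linarith
  nlinarith [mul_nonneg (sub_nonneg.mpr hx.le) hu0]

/-- **`n + 1 ≤ |U_n(x)|` for `|x| ≥ 1`** (parity `U_n(−x) = (−1)^n U_n(x)`). [Rivlin 1974, §1.2; this file, §1286] -/
theorem le_abs_eval_chebyshevU_real (n : ℕ) {x : ℝ} (hx : 1 ≤ |x|) : (n : ℝ) + 1 ≤ |(Polynomial.Chebyshev.U ℝ (n : ℤ)).eval x| := by
  rcases le_or_gt 0 x with h0 | h0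
  · rw [abs_of_nonneg h0] at hx
    exact (le_eval_chebyshevU_real n hx).trans (le_abs_self _)
  · have hx' : 1 ≤ -x := by rwa [abs_of_neg h0] at hx
    have h := le_eval_chebyshevU_real n hx'
    rw [Polynomial.Chebyshev.U_eval_neg, Int.cast_negOnePow_natCast] at h
    calc (n : ℝ) + 1 ≤ (-1) ^ n * (Polynomial.Chebyshev.U ℝ (n : ℤ)).eval x := h
      _ ≤ |(-1) ^ n * (Polynomial.Chebyshev.U ℝ (n : ℤ)).eval x| := le_abs_self _
      _ = |(Polynomial.Chebyshev.U ℝ (n : ℤ)).eval x| := by rw [abs_mul, abs_pow, abs_neg, abs_one, one_pow, one_mul]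

/-- **`n + 1 < |U_n(x)|` for `|x| > 1` and `n ≠ 0`.** [Rivlin 1974, §1.2; this file, §1286] -/
theorem lt_abs_eval_chebyshevU_real {n : ℕ} (hn : n ≠ 0) {x : ℝ} (hx : 1 < |x|) : (n : ℝ) + 1 < |(Polynomial.Chebyshev.U ℝ (n : ℤ)).eval x| := by
  rcases le_or_gt 0 x with h0 | h0
  · rw [abs_of_nonneg h0] at hx
    exact (lt_eval_chebyshevU_real hn hx).trans_le (le_abs_self _)
  · have hx' : 1 < -x := by rwa [abs_of_neg h0] at hx
    have h := lt_eval_chebyshevU_real hn hx'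
    rw [Polynomial.Chebyshev.U_eval_neg, Int.cast_negOnePow_natCast] at h
    calc (n : ℝ) + 1 < (-1) ^ n * (Polynomial.Chebyshev.U ℝ (n : ℤ)).eval x := h
      _ ≤ |(-1) ^ n * (Polynomial.Chebyshev.U ℝ (n : ℤ)).eval x| := le_abs_self _
      _ = |(Polynomial.Chebyshev.U ℝ (n : ℤ)).eval x| := by rw [abs_mul, abs_pow, abs_neg, abs_one, one_pow, one_mul]

/-- **`|x| ≤ 1 ↔ |U_n(x)| ≤ n + 1`** for `n ≠ 0` (the `→` half is the LANDED `Literature…abs_eval_U_le`). [Rivlin 1974, §1.2; DLMF 18.14; this file, §1286] -/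
theorem abs_eval_chebyshevU_real_le_iff {n : ℕ} (hn : n ≠ 0) (x : ℝ) : |x| ≤ 1 ↔ |(Polynomial.Chebyshev.U ℝ (n : ℤ)).eval x| ≤ (n : ℝ) + 1 :=
  ⟨Literature.Probability.FitznerVanDerHofstad2017.abs_eval_U_le n, fun h => not_lt.mp fun h' => not_le.mpr (lt_abs_eval_chebyshevU_real hn h') h⟩

/-! ### `S_n` on `|x| ≥ 2` -/

/-- `S_n(x) = U_n(x∕2)` over `ℝ` (`S_n(2X) = U_n(X)`). [this file, §1286] -/
theorem chebyshevS_eval_eq_U_eval_half (n : ℤ) (x : ℝ) : (Polynomial.Chebyshev.S ℝ n).eval x = (Polynomial.Chebyshev.U ℝ n).eval (x / 2) := by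
  have h := congrArg (Polynomial.eval (x / 2)) (Polynomial.Chebyshev.S_comp_two_mul_X ℝ n)
  rw [eval_comp, eval_mul, eval_ofNat, eval_X, show (2 : ℝ) * (x / 2) = x by ring] at h
  exact h

/-- **`n + 1 ≤ S_n(x)` for `x ≥ 2`** (equality at `x = 2`, Mathlib `S_eval_two`). [Rivlin 1974, §1.2; this file, §1286] -/
theorem le_eval_chebyshevS_real (n : ℕ) {x : ℝ} (hx : 2 ≤ x) : (n : ℝ) + 1 ≤ (Polynomial.Chebyshev.S ℝ (n : ℤ)).eval x := by
  rw [chebyshevS_eval_eq_U_eval_half]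
  exact le_eval_chebyshevU_real n (by linarith)

/-- **`n + 1 < S_n(x)` for `x > 2` and `n ≠ 0`.** [Rivlin 1974, §1.2; this file, §1286] -/
theorem lt_eval_chebyshevS_real {n : ℕ} (hn : n ≠ 0) {x : ℝ} (hx : 2 < x) : (n : ℝ) + 1 < (Polynomial.Chebyshev.S ℝ (n : ℤ)).eval x := by
  rw [chebyshevS_eval_eq_U_eval_half]
  exact lt_eval_chebyshevU_real hn (by linarith)

/-- **`n + 1 ≤ |S_n(x)|` for `|x| ≥ 2`.** [Rivlin 1974, §1.2; this file, §1286] -/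
theorem le_abs_eval_chebyshevS_real (n : ℕ) {x : ℝ} (hx : 2 ≤ |x|) : (n : ℝ) + 1 ≤ |(Polynomial.Chebyshev.S ℝ (n : ℤ)).eval x| := by
  rw [chebyshevS_eval_eq_U_eval_half]
  exact le_abs_eval_chebyshevU_real n (by rw [abs_div, abs_two]; linarith)

/-- **`n + 1 < |S_n(x)|` for `|x| > 2` and `n ≠ 0`.** [Rivlin 1974, §1.2; this file, §1286] -/
theorem lt_abs_eval_chebyshevS_real {n : ℕ} (hn : n ≠ 0) {x : ℝ} (hx : 2 < |x|) : (n : ℝ) + 1 < |(Polynomial.Chebyshev.S ℝ (n : ℤ)).eval x| := by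
  rw [chebyshevS_eval_eq_U_eval_half]
  exact lt_abs_eval_chebyshevU_real hn (by rw [abs_div, abs_two]; linarith)

/-- **`|x| ≤ 2 ↔ |S_n(x)| ≤ n + 1`** for `n ≠ 0` (the `→` half is `Literature…GL2Family.abs_chebyshevS_eval_le`, re-derived here from `abs_eval_U_le` at `x∕2`). [DLMF 18.14; this file, §1286] -/
theorem abs_eval_chebyshevS_real_le_iff {n : ℕ} (hn : n ≠ 0) (x : ℝ) : |x| ≤ 2 ↔ |(Polynomial.Chebyshev.S ℝ (n : ℤ)).eval x| ≤ (n : ℝ) + 1 := by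
  rw [chebyshevS_eval_eq_U_eval_half, ← abs_eval_chebyshevU_real_le_iff hn, abs_div, abs_two, div_le_one (by norm_num : (0 : ℝ) < 2)]

/-! ### `C_n` on `|x| ≥ 2` -/

/-- `C_n(x) = 2T_n(x∕2)` over `ℝ` (`C_n(2X) = 2T_n(X)`). [this file, §1286] -/
theorem chebyshevC_eval_eq_two_mul_T_eval_half (n : ℤ) (x : ℝ) : (Polynomial.Chebyshev.C ℝ n).eval x = 2 * (Polynomial.Chebyshev.T ℝ n).eval (x / 2) := by
  have h := congrArg (Polynomial.eval (x / 2)) (Polynomial.Chebyshev.C_comp_two_mul_X ℝ n)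
  rw [eval_comp, eval_mul, eval_ofNat, eval_X, show (2 : ℝ) * (x / 2) = x by ring, eval_mul, eval_ofNat] at h
  exact h

/-- **`2 ≤ C_n(x)` for `x ≥ 2`** (`n ∈ ℤ`; equality at `x = 2`, Mathlib `C_eval_two`). [Rivlin 1974, §1.2; this file, §1286] -/
theorem two_le_eval_chebyshevC_real (n : ℤ) {x : ℝ} (hx : 2 ≤ x) : 2 ≤ (Polynomial.Chebyshev.C ℝ n).eval x := by
  rw [chebyshevC_eval_eq_two_mul_T_eval_half]
  have h := Polynomial.Chebyshev.one_le_eval_T_real n (show (1 : ℝ) ≤ x / 2 by linarith)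
  linarith

/-- **`2 < C_n(x)` for `x > 2` and `n ≠ 0`.** [Rivlin 1974, §1.2; this file, §1286] -/
theorem two_lt_eval_chebyshevC_real {n : ℤ} (hn : n ≠ 0) {x : ℝ} (hx : 2 < x) : 2 < (Polynomial.Chebyshev.C ℝ n).eval x := by
  rw [chebyshevC_eval_eq_two_mul_T_eval_half]
  have h := Polynomial.Chebyshev.one_lt_eval_T_real hn (show (1 : ℝ) < x / 2 by linarith)
  linarith

/-- **`2 ≤ |C_n(x)|` for `|x| ≥ 2`** (`n ∈ ℤ`). [Rivlin 1974, §1.2; this file, §1286] -/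
theorem two_le_abs_eval_chebyshevC_real (n : ℤ) {x : ℝ} (hx : 2 ≤ |x|) : 2 ≤ |(Polynomial.Chebyshev.C ℝ n).eval x| := by
  rw [chebyshevC_eval_eq_two_mul_T_eval_half, abs_mul, abs_two]
  have h := Polynomial.Chebyshev.one_le_abs_eval_T_real n (show (1 : ℝ) ≤ |x / 2| by rw [abs_div, abs_two]; linarith)
  linarith

/-- **`2 < |C_n(x)|` for `|x| > 2` and `n ≠ 0`.** [Rivlin 1974, §1.2; this file, §1286] -/
theorem two_lt_abs_eval_chebyshevC_real {n : ℤ} (hn : n ≠ 0) {x : ℝ} (hx : 2 < |x|) : 2 < |(Polynomial.Chebyshev.C ℝ n).eval x| := by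
  rw [chebyshevC_eval_eq_two_mul_T_eval_half, abs_mul, abs_two]
  have h := Polynomial.Chebyshev.one_lt_abs_eval_T_real hn (show (1 : ℝ) < |x / 2| by rw [abs_div, abs_two]; linarith)
  linarith

/-- **`|x| ≤ 2 ↔ |C_n(x)| ≤ 2`** for `n ≠ 0` (the `→` half is `Literature…SymmSqLogEuler.abs_chebyshevC_eval_le`, re-derived here from Mathlib `abs_eval_T_real_le_one` at `x∕2`).
[Rivlin 1974, §1.2; this file, §1286] -/
theorem abs_eval_chebyshevC_real_le_two_iff {n : ℤ} (hn : n ≠ 0) (x : ℝ) : |x| ≤ 2 ↔ |(Polynomial.Chebyshev.C ℝ n).eval x| ≤ 2 := by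
  constructor
  · intro h
    rw [chebyshevC_eval_eq_two_mul_T_eval_half, abs_mul, abs_two]
    have hT := Polynomial.Chebyshev.abs_eval_T_real_le_one n (show |x / 2| ≤ 1 by rw [abs_div, abs_two]; linarith)
    linarith
  · exact fun h => not_lt.mp fun h' => not_le.mpr (two_lt_abs_eval_chebyshevC_real hn h') h

end Summit.Ventures.HSemireg.Wedge.HankelOuter
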